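/-
Copyright (c) 2026 the pub-hodgecm-mathlib formalisation cell (harness21).  Prover seat hodgecm-mathlib-R90-C10-p02 (g3), SLAB R90-TF, section S1 «Ch. 10∕12 local»
(base R90-C10); crux H413 = `stmt-HodgeConjecture-24833`; line (D-1) «B_pos at INERT places» of U4Keys :182 (S1 junction A2′), memo
`R90/R90-C10-p05/g2/DESIGN-Bpos-inert.md` f70d293d60bf8a4b; card (B-5z) «the `HE` discharge modulo the master» dealt BY NAME by R90-C10-plan (g2) 2026-09-05T00:35:59Z,
FILE B of its cut (the indicator forms).  KERNEL module: THEOREMS ONLY (no definition, no named fact, no `sorry`, no instance, no notation).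
-/
import Summits.HodgeConjecture.HodgeConjecture.Theorems.R90S1BposPairIntegrandsVanishingTwoDepth   -- FILE A′ (this seat): the four vanishing lemmas; brings FILE A (the values, the frame lemmas), ★ (B-0), ★ (B-2b′)
import Summits.HodgeConjecture.HodgeConjecture.Theorems.R90S1BposShellLevelSets                    -- ★ p863786 (B-5) part 2a (R90-C10-p05 (g2)): `measurableSet_setOf_valued_eq_exp`; brings ★ p863641 part 1 `isCompact_setOf_valued_le_exp`
import Summits.HodgeConjecture.HodgeConjecture.Theorems.K2E3BranchBCasselmanPairEntries             -- ★ (K2E3-p03 (g9)) d0B: `setOf_v_le_one_eq_setOf_mem` (`N₀ = {n ∈ I}`); brings ★ `K2E3BranchBHaarFactsN` (`measure_setOf_coe_mem_lt_top`), ★ `K2E3BranchBShellRegions`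
import HarnessLib

/-!
# R90-TF · S1 «Ch10-local» ∕ K2 E3 «U4Keys» :182, BRANCH B AT POSITIVE DEPTH (inert) — brick (B-5z) FILE B: THE FOUR CASSELMAN-PAIR INTEGRANDS AT `J_e` AS INDICATORS, THEIR
# SUPPORTS AS BOXES ∕ CUT-OFF REGIONS OF `N(L⁺_v)`, MEASURABILITY AND FINITE MASS
# `f_w(w₀n) = 𝟙_{B(r₁,0)}(n)`, `f₁(w₀nw₀) = 𝟙_{B(r₂,1)}(n)`, `f_w(w₀nw₀) = 𝟙_{C(r₁,0)}(n)·F₀(n)`, `f₁(w₀n) = 𝟙_{C(r₂,1)}(n)·F₀(n)` (memo (M12), (M21), (M22), (M11))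
# [Casselman1980 §3; Casselman1995 §6.3–§6.4; Roche1998 §3–§4; Keys1984 §7 Thm (2); Rogawski1990 §1.10]

Cell `pub/hodgecm-mathlib`, crux H413 = `stmt-HodgeConjecture-24833`, route of record `HCCMUnconditional` (no route verbs); R90-TF section S1 (junction socket A2′ = U4Keys :217, REL
over :155 and :182).  THEOREMS ONLY; lane `--supports stmt-HodgeConjecture-24833 --as helper`, count-neutral.  NOT THE PAYER of :182: consumed by FILE C `R90S1BposPairEntriesOfMaster`
(the four entries from the master-integral letter `hMaster` of (B-5) part 3 and a box-volume letter), which instantiates `HE` of ★ p863671 `R90S1KeysThmTwoPosDepthBranchBInertAllLeaf` §2.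
FRAME = FILE A's + the Iwahori letters `(g₁ hg₁ K0 K1 I hK0 hK1 hI)` of the (G3) frame (only for `N₀ = {n ∈ I}` ★ `setOf_v_le_one_eq_setOf_mem` and its finite mass ★ `measure_setOf_coe_mem_lt_top`).
SETS (all in `N(L⁺_v)`, `z = n₀₂`, `x = n₀₁` read at `w`): the BOX `B(ρ, j) = {|z|_w ≤ |ϖ|ʲ ∧ |x|_w ≤ |ϖ|^ρ}` and the CUT-OFF REGION `C(ρ, j₀) = {exp j₀ ≤ |z|_w ∧ |x|_w ≤ |ϖ|^ρ·|z|_w}` — the latter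
in EXACTLY the bytes of the (B-5) part-3 head `R90.S1.BposMasterIntegral.setIntegral_cutoff_F₀_eq` (lead R90-C10-p05 (g2) 2026-09-05T00:48:29Z); `F₀` = the frame-v1 integrand.
* §1 measurability ∕ finite mass of `B`, `C`; §2 `{n : n ∈ J_e} = B(r₁,0)`, `{n : w₀nw₀ ∈ J_e} = B(r₂,1)`; §3 the four INDICATOR identities (FILE A ∕ A′ pointwise, trichotomies resolved).
HONEST LABEL.  HC_CM is proved only modulo the 7 printed citations (2 remaining named inputs: hLiu418 = `stmt-HodgeConjecture-24832`, h413 = `stmt-HodgeConjecture-24833`) until rung 0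
closes; count-neutral — indicator identities close NOTHING; :182 ∕ A2′ OPEN; REL ≠ ★ ≠ BUILT.

## References
* [Casselman1980] W. Casselman, Compositio Math. 40 (1980), §3. * [Casselman1995] W. Casselman, *Introduction to … `p`-adic reductive groups* (1995), Prop. 1.3.1, §6.3–§6.4.
* [Roche1998] A. Roche, Ann. Sci. ÉNS (4) 31 (1998), §3–§4. * [Keys1984] D. Keys, Compositio Math. 51 (1984), §3, §7 Theorem (2) p. 126.
* [Rogawski1990] J. D. Rogawski, Ann. of Math. Stud. 123 (1990), §1.10 p. 9, §12.1 p. 171. * [BruhatTits1972] F. Bruhat, J. Tits, Publ. Math. IHÉS 41 (1972), (6.4.9).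
-/

set_option autoImplicit false
set_option linter.dupNamespace false  -- the mandated namespace has the single-problem summit's repeated segment (`HodgeConjecture.HodgeConjecture`)

noncomputable section

open NumberField IsDedekindDomain MeasureTheory
open scoped Matrix MatrixGroups WithZero Valued NNReal
open Literature.NumberTheory Literature.NumberTheory.Automorphic Literature.NumberTheory.Automorphic.UnitaryGroup
open Literature.NumberTheory.Rogawski1990

namespace Summit.HodgeConjecture.HodgeConjecture.R90.S1.BposPairIntegrandsTwoDepth

open Summit.HodgeConjecture.HodgeConjecture.Cruxes.H413
open Summit.HodgeConjecture.HodgeConjecture.Cruxes.H413.K2E3DepthZeroIwahoriCharacterCM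
open Summit.HodgeConjecture.HodgeConjecture.Cruxes.H413.K2E3BranchALettersCM
open Summit.HodgeConjecture.HodgeConjecture.Cruxes.H413.K2E3BranchBCellFunctionsCM
open Summit.HodgeConjecture.HodgeConjecture.R90.S1

variable (L : Type) [Field L] [NumberField L] [IsCMField L] (v : HeightOneSpectrum (𝓞 ↥(maximalRealSubfield L)))
  (w : PlacesOver L v) (hw : IsCMField.complexConj L • w.1 = w.1)
  (eA : Gqs L v ≃ₜ* ↥(unitaryGroupOfForm (galAdicCompletionMap (L := L) (IsCMField.complexConj L) hw) ((StdForm.antidiagonal 3).over (w.1.adicCompletion L))))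
  (heA : ∀ g : Gqs L v,
    ((eA g : ↥(unitaryGroupOfForm (galAdicCompletionMap (L := L) (IsCMField.complexConj L) hw) ((StdForm.antidiagonal 3).over (w.1.adicCompletion L)))) :
        GL (Fin 3) (w.1.adicCompletion L)) =
      ((localNonsplitEquiv (IsCMField.complexConj L) (qsForm L) (IsCMField.complexConj_ne_one L) w hw g :
        ↥(unitaryGroupOfForm (galAdicCompletionMap (L := L) (IsCMField.complexConj L) hw) (placeForm (qsForm L) w.1))) : GL (Fin 3) (w.1.adicCompletion L)))
  {ϖ : w.1.adicCompletion L} (hϖ : Valued.v ϖ = WithZero.exp (-1 : ℤ))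
  (g₁ : GL (Fin 3) (w.1.adicCompletion L)) (hg₁ : (g₁ : Matrix (Fin 3) (Fin 3) (w.1.adicCompletion L)) = Matrix.diagonal ![(1 : w.1.adicCompletion L), 1, ϖ])
  (K0 K1 I : Subgroup (Gqs L v))
  (hK0 : K0 = ((glInt 3 (w.1.adicCompletion L)).subgroupOf
    (unitaryGroupOfForm (galAdicCompletionMap (L := L) (IsCMField.complexConj L) hw) ((StdForm.antidiagonal 3).over (w.1.adicCompletion L)))).comap
      eA.toMulEquiv.toMonoidHom)
  (hK1 : K1 = (((glInt 3 (w.1.adicCompletion L)).map (MulAut.conj g₁).toMonoidHom).subgroupOf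
    (unitaryGroupOfForm (galAdicCompletionMap (L := L) (IsCMField.complexConj L) hw) ((StdForm.antidiagonal 3).over (w.1.adicCompletion L)))).comap
      eA.toMulEquiv.toMonoidHom)
  (hI : I = K0 ⊓ K1)
  (r₁ r₂ : ℕ) (Jg : Subgroup ↥(unitaryGroupOfForm (galAdicCompletionMap (L := L) (IsCMField.complexConj L) hw) ((StdForm.antidiagonal 3).over (w.1.adicCompletion L))))
  (hJg : ∀ k : ↥(unitaryGroupOfForm (galAdicCompletionMap (L := L) (IsCMField.complexConj L) hw) ((StdForm.antidiagonal 3).over (w.1.adicCompletion L))),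
    k ∈ Jg ↔ ∀ i j, Valued.v (((k : GL (Fin 3) (w.1.adicCompletion L)) : Matrix (Fin 3) (Fin 3) (w.1.adicCompletion L)) i j) ≤
      Valued.v ϖ ^ (![![0, r₁, 0], ![r₂, 0, r₁], ![1, r₂, 0]] : Fin 3 → Fin 3 → ℕ) i j)
  (Je : Subgroup (Gqs L v)) (hJe : Je = Jg.comap eA.toMulEquiv.toMonoidHom)
  (w₀ : ↥(unitaryGroupOfForm (conjLocal L (IsCMField.complexConj L) v) (cmLocalForm L 3 v))) (hw₀ : Units.val (w₀ : GL (Fin 3) (LocalRing L v)) = cmLocalForm L 3 v)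

/-! ## §1 Boxes and cut-off regions of `N(L⁺_v)`: measurability, finite mass -/
/-- `n ↦ n_{ij}` is continuous on `N(L⁺_v)` (★ `K2E3BranchBShellRegions.continuous_entry_zero_two` at any entry). [cite: Rogawski1990, §1.10 p. 9] -/
theorem continuous_entry (i j : Fin 3) :
    Continuous (fun n : ↥(cmBorelTriple L 3 v).N => ((n : ↥(unitaryGroupOfForm (conjLocal L (IsCMField.complexConj L) v) (cmLocalForm L 3 v))) : GL (Fin 3) (LocalRing L v)).val i j) := by
  have h1 : Continuous (fun n : ↥(cmBorelTriple L 3 v).N => (n : ↥(unitaryGroupOfForm (conjLocal L (IsCMField.complexConj L) v) (cmLocalForm L 3 v)))) := continuous_subtype_val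
  have h2 : Continuous (fun u : ↥(unitaryGroupOfForm (conjLocal L (IsCMField.complexConj L) v) (cmLocalForm L 3 v)) => (u : GL (Fin 3) (LocalRing L v))) := continuous_subtype_val
  have h3 : Continuous (fun g : GL (Fin 3) (LocalRing L v) => g.val) := Units.continuous_val
  exact (h3.comp (h2.comp h1)).matrix_elem i j
include hw hϖ in
/-- `|ϖ|ʲ = exp(−j)` and the ball `{x : R | |x_w| ≤ |ϖ|ʲ}` is closed (★ part 1 `isCompact_setOf_valued_le_exp`). [cite: Rogawski1990, §1.10 p. 9] -/
theorem isClosed_setOf_valued_apply_le_pow (hunr : Algebra.IsUnramifiedIn (𝓞 L) v.asIdeal) (j : ℕ) :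
    IsClosed {x : LocalRing L v | Valued.v (x w) ≤ Valued.v ϖ ^ j} := by
  have hj : Valued.v ϖ ^ j = WithZero.exp (-(j : ℤ)) := by
    rw [hϖ, ← WithZero.exp_nsmul]; simp
  rw [hj]
  exact (BposChartAndMasses.isCompact_setOf_valued_le_exp L v w hw hunr (-(j : ℤ))).isClosed
include hw hϖ in
/-- **The box `B(ρ, j)` is Borel.** [cite: Rogawski1990, §1.10 p. 9] -/
theorem measurableSet_box (hunr : Algebra.IsUnramifiedIn (𝓞 L) v.asIdeal) [MeasurableSpace ↥(cmBorelTriple L 3 v).N] [BorelSpace ↥(cmBorelTriple L 3 v).N] (ρ j : ℕ) :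
    MeasurableSet {m : ↥(cmBorelTriple L 3 v).N | Valued.v (((((m : ↥(unitaryGroupOfForm (conjLocal L (IsCMField.complexConj L) v) (cmLocalForm L 3 v))) : GL (Fin 3) (LocalRing L v)) : Matrix (Fin 3) (Fin 3) (LocalRing L v)) 0 2) w) ≤ Valued.v ϖ ^ j ∧ Valued.v (((((m : ↥(unitaryGroupOfForm (conjLocal L (IsCMField.complexConj L) v) (cmLocalForm L 3 v))) : GL (Fin 3) (LocalRing L v)) : Matrix (Fin 3) (Fin 3) (LocalRing L v)) 0 1) w) ≤ Valued.v ϖ ^ ρ} :=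
  (((isClosed_setOf_valued_apply_le_pow L v w hw hϖ hunr j).preimage (continuous_entry L v 0 2)).inter
    ((isClosed_setOf_valued_apply_le_pow L v w hw hϖ hunr ρ).preimage (continuous_entry L v 0 1))).measurableSet
include hϖ in
/-- `B(ρ, j) ⊆ N₀ = {|z|_w ≤ 1}`. [cite: Rogawski1990, §1.10 p. 9] -/
theorem box_subset_setOf_v_le_one (ρ j : ℕ) :
    {m : ↥(cmBorelTriple L 3 v).N | Valued.v (((((m : ↥(unitaryGroupOfForm (conjLocal L (IsCMField.complexConj L) v) (cmLocalForm L 3 v))) : GL (Fin 3) (LocalRing L v)) : Matrix (Fin 3) (Fin 3) (LocalRing L v)) 0 2) w) ≤ Valued.v ϖ ^ j ∧ Valued.v (((((m : ↥(unitaryGroupOfForm (conjLocal L (IsCMField.complexConj L) v) (cmLocalForm L 3 v))) : GL (Fin 3) (LocalRing L v)) : Matrix (Fin 3) (Fin 3) (LocalRing L v)) 0 1) w) ≤ Valued.v ϖ ^ ρ} ⊆ {m : ↥(cmBorelTriple L 3 v).N | Valued.v (((((m : ↥(unitaryGroupOfForm (conjLocal L (IsCMField.complexConj L) v) (cmLocalForm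 L 3 v))) : GL (Fin 3) (LocalRing L v)) : Matrix (Fin 3) (Fin 3) (LocalRing L v)) 0 2) w) ≤ 1} := by
  intro m hm
  have hvϖ1 : Valued.v ϖ ≤ 1 := by rw [hϖ, ← WithZero.exp_zero, WithZero.exp_le_exp]; norm_num
  exact hm.1.trans (pow_le_one' hvϖ1 j)
include hw heA hϖ hg₁ hK0 hK1 hI in
/-- **The box `B(ρ, j)` has finite mass** for every measure finite on compacts (`⊆ N₀ = {n ∈ I}` ★ `setOf_v_le_one_eq_setOf_mem`, ★ `measure_setOf_coe_mem_lt_top`). [cite: Casselman1980, §3] -/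
theorem measure_box_lt_top [instM : MeasurableSpace ↥(cmBorelTriple L 3 v).N] (μ : Measure ↥(cmBorelTriple L 3 v).N) [instF : IsFiniteMeasureOnCompacts μ] (ρ j : ℕ) :
    μ {m : ↥(cmBorelTriple L 3 v).N | Valued.v (((((m : ↥(unitaryGroupOfForm (conjLocal L (IsCMField.complexConj L) v) (cmLocalForm L 3 v))) : GL (Fin 3) (LocalRing L v)) : Matrix (Fin 3) (Fin 3) (LocalRing L v)) 0 2) w) ≤ Valued.v ϖ ^ j ∧ Valued.v (((((m : ↥(unitaryGroupOfForm (conjLocal L (IsCMField.complexConj L) v) (cmLocalForm L 3 v))) : GL (Fin 3) (LocalRing L v)) : Matrix (Fin 3) (Fin 3) (LocalRing L v)) 0 1) w) ≤ Valued.v ϖ ^ ρ} < ⊤ := by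
  have hsub : {m : ↥(cmBorelTriple L 3 v).N | Valued.v (((((m : ↥(unitaryGroupOfForm (conjLocal L (IsCMField.complexConj L) v) (cmLocalForm L 3 v))) : GL (Fin 3) (LocalRing L v)) : Matrix (Fin 3) (Fin 3) (LocalRing L v)) 0 2) w) ≤ Valued.v ϖ ^ j ∧ Valued.v (((((m : ↥(unitaryGroupOfForm (conjLocal L (IsCMField.complexConj L) v) (cmLocalForm L 3 v))) : GL (Fin 3) (LocalRing L v)) : Matrix (Fin 3) (Fin 3) (LocalRing L v)) 0 1) w) ≤ Valued.v ϖ ^ ρ} ⊆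
      {m : ↥(cmBorelTriple L 3 v).N | (m : ↥(unitaryGroupOfForm (conjLocal L (IsCMField.complexConj L) v) (cmLocalForm L 3 v))) ∈ I} := by
    rw [← K2E3BranchBCasselmanPairEntries.setOf_v_le_one_eq_setOf_mem L v w hw eA heA hϖ g₁ hg₁ K0 K1 I hK0 hK1 hI]
    exact box_subset_setOf_v_le_one L v w hϖ ρ j
  exact lt_of_le_of_lt (measure_mono hsub)
    (@K2E3BranchBHaarFactsN.measure_setOf_coe_mem_lt_top L _ _ _ v w hw eA g₁ K0 K1 I hK0 hK1 hI (cmBorelTriple L 3 v) rfl instM μ instF)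
include hw hϖ in
set_option maxHeartbeats 400000 in
/-- **The cut-off region `C(ρ, j₀)` is Borel**: it is the countable union over the shells `|z|_w = exp(j₀ + i)` (`i ∈ ℕ`; `|z| ∈ {0} ∪ exp ℤ`) of «sphere in `z`» ∩ «ball `|x|_w ≤ exp(j₀ + i − ρ)`»
(★ part 2a `measurableSet_setOf_valued_eq_exp`, ★ part 1 `isCompact_setOf_valued_le_exp`). [cite: Rogawski1990, §1.10 p. 9] -/
theorem measurableSet_cutoff (hunr : Algebra.IsUnramifiedIn (𝓞 L) v.asIdeal) [MeasurableSpace ↥(cmBorelTriple L 3 v).N] [BorelSpace ↥(cmBorelTriple L 3 v).N] (ρ : ℕ) (j₀ : ℤ) :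
    MeasurableSet {n : ↥(cmBorelTriple L 3 v).N | WithZero.exp (j₀ : ℤ) ≤ Valued.v (((((n : ↥(unitaryGroupOfForm (conjLocal L (IsCMField.complexConj L) v) (cmLocalForm L 3 v))) : GL (Fin 3) (LocalRing L v)) : Matrix (Fin 3) (Fin 3) (LocalRing L v)) 0 2) w) ∧ Valued.v (((((n : ↥(unitaryGroupOfForm (conjLocal L (IsCMField.complexConj L) v) (cmLocalForm L 3 v))) : GL (Fin 3) (LocalRing L v)) : Matrix (Fin 3) (Fin 3) (LocalRing L v)) 0 1) w) ≤ Valued.v ϖ ^ ρ * Valued.v (((((n : ↥(unitaryGroupOfForm (conjLocal L (IsCMField.complexConj L) v) (cmLocalForm L 3 v))) : GL (Fin 3) (LocalRing L v)) : Matrix (Fin 3) (Fin 3) (LocalRing L v)) 0 2) w)} := by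
  letI : MeasurableSpace (LocalRing L v) := borel _
  haveI : BorelSpace (LocalRing L v) := ⟨rfl⟩
  have hρ : Valued.v ϖ ^ ρ = WithZero.exp (-(ρ : ℤ)) := by rw [hϖ, ← WithZero.exp_nsmul]; simp
  have hset : {n : ↥(cmBorelTriple L 3 v).N | WithZero.exp (j₀ : ℤ) ≤ Valued.v (((((n : ↥(unitaryGroupOfForm (conjLocal L (IsCMField.complexConj L) v) (cmLocalForm L 3 v))) : GL (Fin 3) (LocalRing L v)) : Matrix (Fin 3) (Fin 3) (LocalRing L v)) 0 2) w) ∧ Valued.v (((((n : ↥(unitaryGroupOfForm (conjLocal L (IsCMField.complexConj L) v) (cmLocalForm L 3 v))) : GL (Fin 3) (LocalRing L v)) : Matrix (Fin 3) (Fin 3) (LocalRing L v)) 0 1) w) ≤ Valued.v ϖ ^ ρ * Valued.v (((((n : ↥(unitaryGroupOfForm (conjLocal L (IsCMField.complexConj L) v) (cmLocalForm L 3 v))) : GL (Fin 3) (LocalRing L v)) : Matrix (Fin 3) (Fin 3) (LocalRing L v)) 0 2) w)} = ⋃ i : ℕ,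
      ((fun n : ↥(cmBorelTriple L 3 v).N => ((((n : ↥(unitaryGroupOfForm (conjLocal L (IsCMField.complexConj L) v) (cmLocalForm L 3 v))) : GL (Fin 3) (LocalRing L v)) : Matrix (Fin 3) (Fin 3) (LocalRing L v)) 0 2)) ⁻¹' {x : LocalRing L v | Valued.v (x w) = WithZero.exp (j₀ + i)} ∩
        (fun n : ↥(cmBorelTriple L 3 v).N => ((((n : ↥(unitaryGroupOfForm (conjLocal L (IsCMField.complexConj L) v) (cmLocalForm L 3 v))) : GL (Fin 3) (LocalRing L v)) : Matrix (Fin 3) (Fin 3) (LocalRing L v)) 0 1)) ⁻¹' {x : LocalRing L v | Valued.v (x w) ≤ WithZero.exp (j₀ + i - ρ)}) := by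
    ext n
    simp only [Set.mem_setOf_eq, Set.mem_iUnion, Set.mem_inter_iff, Set.mem_preimage]
    constructor
    · rintro ⟨hz, hx⟩
      have hz0 : Valued.v (((((n : ↥(unitaryGroupOfForm (conjLocal L (IsCMField.complexConj L) v) (cmLocalForm L 3 v))) : GL (Fin 3) (LocalRing L v)) : Matrix (Fin 3) (Fin 3) (LocalRing L v)) 0 2) w) ≠ 0 := fun h => by rw [h] at hz; exact absurd hz (not_le.2 (by simp))
      obtain ⟨k, hk⟩ : ∃ k : ℤ, Valued.v (((((n : ↥(unitaryGroupOfForm (conjLocal L (IsCMField.complexConj L) v) (cmLocalForm L 3 v))) : GL (Fin 3) (LocalRing L v)) : Matrix (Fin 3) (Fin 3) (LocalRing L v)) 0 2) w) = WithZero.exp k := ⟨_, (WithZero.exp_log hz0).symm⟩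
      rw [hk, WithZero.exp_le_exp] at hz
      refine ⟨(k - j₀).toNat, ?_, ?_⟩
      · rw [hk]; congr 1; omega
      · rw [hk, hρ, ← WithZero.exp_add] at hx
        refine hx.trans (le_of_eq ?_); congr 1; omega
    · rintro ⟨i, hz, hx⟩
      refine ⟨by rw [hz, WithZero.exp_le_exp]; omega, ?_⟩
      rw [hz, hρ, ← WithZero.exp_add]
      refine hx.trans (le_of_eq ?_); congr 1; omega
  rw [hset]
  exact MeasurableSet.iUnion fun i =>
    ((BposShellLevelSets.measurableSet_setOf_valued_eq_exp L v w hw hunr (j₀ + i)).preimage (continuous_entry L v 0 2).measurable).inter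
      ((BposChartAndMasses.isCompact_setOf_valued_le_exp L v w hw hunr (j₀ + i - ρ)).isClosed.measurableSet.preimage (continuous_entry L v 0 1).measurable)

/-- `C(ρ, j₀) ⊆ S_ge = {1 ≤ |z|_w}` for `0 ≤ j₀` (so ★ `integrableOn_F₀_S_ge` restricts to it). [cite: Keys1984, §7] -/
theorem cutoff_subset_setOf_one_le_v (ρ : ℕ) {j₀ : ℤ} (hj₀ : 0 ≤ j₀) :
    {n : ↥(cmBorelTriple L 3 v).N | WithZero.exp (j₀ : ℤ) ≤ Valued.v (((((n : ↥(unitaryGroupOfForm (conjLocal L (IsCMField.complexConj L) v) (cmLocalForm L 3 v))) : GL (Fin 3) (LocalRing L v)) : Matrix (Fin 3) (Fin 3) (LocalRing L v)) 0 2) w) ∧ Valued.v (((((n : ↥(unitaryGroupOfForm (conjLocal L (IsCMField.complexConj L) v) (cmLocalForm L 3 v))) : GL (Fin 3) (LocalRing L v)) : Matrix (Fin 3) (Fin 3) (LocalRing L v)) 0 1) w) ≤ Valued.v ϖ ^ ρ * Valued.v (((((n : ↥(unitaryGroupOfForm (conjLocal L (IsCMField.complexConj L) v) (cmLocalForm L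 3 v))) : GL (Fin 3) (LocalRing L v)) : Matrix (Fin 3) (Fin 3) (LocalRing L v)) 0 2) w)} ⊆ {m : ↥(cmBorelTriple L 3 v).N | 1 ≤ Valued.v (((((m : ↥(unitaryGroupOfForm (conjLocal L (IsCMField.complexConj L) v) (cmLocalForm L 3 v))) : GL (Fin 3) (LocalRing L v)) : Matrix (Fin 3) (Fin 3) (LocalRing L v)) 0 2) w)} := fun n hn =>
  le_trans (by rw [← WithZero.exp_zero, WithZero.exp_le_exp]; exact hj₀) hn.1

/-! ## §2 The two `J_e`-membership sets are boxes -/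
include hw heA hJg hJe in
/-- **`{n ∈ N : n ∈ J_e} = B(r₁, 0)`**: `eA n = u(x, z)`, and the two-depth test at `e = (r₁, 0; r₂, 1)` reads `|x| ≤ |ϖ|^{r₁}`, `|z| ≤ |ϖ|⁰` (★ p862537 `mem_of_coe_eq_upper`; the converse from
the `(0,1)`, `(0,2)` entries of `hJg`).  The support of `n ↦ f_w(w₀n)` (memo (M12)). [cite: BruhatTits1972, (6.4.9)] [cite: Roche1998, §3] -/
theorem setOf_mem_levelGroup_eq_box :
    {m : ↥(cmBorelTriple L 3 v).N | (m : ↥(unitaryGroupOfForm (conjLocal L (IsCMField.complexConj L) v) (cmLocalForm L 3 v))) ∈ Je} = {m : ↥(cmBorelTriple L 3 v).N | Valued.v (((((m : ↥(unitaryGroupOfForm (conjLocal L (IsCMField.complexConj L) v) (cmLocalForm L 3 v))) : GL (Fin 3) (LocalRing L v)) : Matrix (Fin 3) (Fin 3) (LocalRing L v)) 0 2) w) ≤ Valued.v ϖ ^ 0 ∧ Valued.v (((((m : ↥(unitaryGroupOfForm (conjLocal L (IsCMField.complexConj L) v) (cmLocalForm L 3 v))) : GL (Fin 3) (LocalRing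 L v)) : Matrix (Fin 3) (Fin 3) (LocalRing L v)) 0 1) w) ≤ Valued.v ϖ ^ r₁} := by
  have hvσ : ∀ y, Valued.v (galAdicCompletionMap (L := L) (IsCMField.complexConj L) hw y) = Valued.v y :=
    fun y => valued_galAdicCompletionMap (L := L) (IsCMField.complexConj L) hw y
  ext m
  obtain ⟨x, z, hux, hrel⟩ := exists_coe_eA_eq_upper L v w hw eA heA (cmBorelTriple L 3 v) rfl m.2
  have hz02 : (((((m : ↥(unitaryGroupOfForm (conjLocal L (IsCMField.complexConj L) v) (cmLocalForm L 3 v))) : GL (Fin 3) (LocalRing L v)) : Matrix (Fin 3) (Fin 3) (LocalRing L v)) 0 2) w) = z := by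
    rw [← coe_eA_apply L v w hw eA heA (m : ↥(unitaryGroupOfForm (conjLocal L (IsCMField.complexConj L) v) (cmLocalForm L 3 v))) 0 2, hux]; rfl
  have hx01 : (((((m : ↥(unitaryGroupOfForm (conjLocal L (IsCMField.complexConj L) v) (cmLocalForm L 3 v))) : GL (Fin 3) (LocalRing L v)) : Matrix (Fin 3) (Fin 3) (LocalRing L v)) 0 1) w) = x := by
    rw [← coe_eA_apply L v w hw eA heA (m : ↥(unitaryGroupOfForm (conjLocal L (IsCMField.complexConj L) v) (cmLocalForm L 3 v))) 0 1, hux]; rfl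
  simp only [Set.mem_setOf_eq]
  rw [hz02, hx01]
  subst hJe
  change eA ((m : ↥(unitaryGroupOfForm (conjLocal L (IsCMField.complexConj L) v) (cmLocalForm L 3 v))) : Gqs L v) ∈ Jg ↔ _
  constructor
  · intro hk
    have h := (hJg _).1 hk
    exact ⟨by simpa [hux] using h 0 2, by simpa [hux] using h 0 1⟩
  · rintro ⟨hz, hx⟩
    exact K2E3LowerUnipotentDeepCellTwoDepth.mem_of_coe_eq_upper (galAdicCompletionMap (L := L) (IsCMField.complexConj L) hw) hvσ _ Jg hJg
      (fun i => by fin_cases i <;> rfl) (fun i j => by fin_cases i <;> fin_cases j <;> rfl) hux hx hz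
include hw heA hJg hJe hw₀ in
/-- **`{n ∈ N : w₀nw₀ ∈ J_e} = B(r₂, 1)`**: `eA(w₀nw₀) = ū(x, z)` (★ `coe_eA_conj_eq_lower`) and the test reads `|x| ≤ |ϖ|^{r₂}`, `|z| ≤ |ϖ|¹` (FILE A `mem_levelGroup_of_coe_eq_lower`; converse from the
`(2,1)`, `(2,0)` entries).  The support of `n ↦ f₁(w₀nw₀)` (memo (M21)). [cite: BruhatTits1972, (6.4.9)] [cite: Roche1998, §3] -/
theorem setOf_conj_mem_levelGroup_eq_box :
    {m : ↥(cmBorelTriple L 3 v).N | w₀ * (m : ↥(unitaryGroupOfForm (conjLocal L (IsCMField.complexConj L) v) (cmLocalForm L 3 v))) * w₀ ∈ Je} = {m : ↥(cmBorelTriple L 3 v).N | Valued.v (((((m : ↥(unitaryGroupOfForm (conjLocal L (IsCMField.complexConj L) v) (cmLocalForm L 3 v))) : GL (Fin 3) (LocalRing L v)) : Matrix (Fin 3) (Fin 3) (LocalRing L v)) 0 2) w) ≤ Valued.v ϖ ^ 1 ∧ Valued.v (((((m : ↥(unitaryGroupOfForm (conjLocal L (IsCMField.complexConj L) v) (cmLocalForm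 L 3 v))) : GL (Fin 3) (LocalRing L v)) : Matrix (Fin 3) (Fin 3) (LocalRing L v)) 0 1) w) ≤ Valued.v ϖ ^ r₂} := by
  have hvσ : ∀ y, Valued.v (galAdicCompletionMap (L := L) (IsCMField.complexConj L) hw y) = Valued.v y :=
    fun y => valued_galAdicCompletionMap (L := L) (IsCMField.complexConj L) hw y
  ext m
  obtain ⟨x, z, hux, -⟩ := exists_coe_eA_eq_upper L v w hw eA heA (cmBorelTriple L 3 v) rfl m.2
  have hz02 : (((((m : ↥(unitaryGroupOfForm (conjLocal L (IsCMField.complexConj L) v) (cmLocalForm L 3 v))) : GL (Fin 3) (LocalRing L v)) : Matrix (Fin 3) (Fin 3) (LocalRing L v)) 0 2) w) = z := by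
    rw [← coe_eA_apply L v w hw eA heA (m : ↥(unitaryGroupOfForm (conjLocal L (IsCMField.complexConj L) v) (cmLocalForm L 3 v))) 0 2, hux]; rfl
  have hx01 : (((((m : ↥(unitaryGroupOfForm (conjLocal L (IsCMField.complexConj L) v) (cmLocalForm L 3 v))) : GL (Fin 3) (LocalRing L v)) : Matrix (Fin 3) (Fin 3) (LocalRing L v)) 0 1) w) = x := by
    rw [← coe_eA_apply L v w hw eA heA (m : ↥(unitaryGroupOfForm (conjLocal L (IsCMField.complexConj L) v) (cmLocalForm L 3 v))) 0 1, hux]; rfl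
  have hlow := coe_eA_conj_eq_lower L v w hw eA heA w₀ hw₀ hux
  simp only [Set.mem_setOf_eq]
  rw [hz02, hx01]
  constructor
  · intro hk
    subst hJe
    have hk' : eA (w₀ * (m : ↥(unitaryGroupOfForm (conjLocal L (IsCMField.complexConj L) v) (cmLocalForm L 3 v))) * w₀) ∈ Jg := hk
    have h := (hJg _).1 hk'
    have hlow' : (((eA (w₀ * (m : ↥(unitaryGroupOfForm (conjLocal L (IsCMField.complexConj L) v) (cmLocalForm L 3 v))) * w₀) : ↥(unitaryGroupOfForm (galAdicCompletionMap (L := L) (IsCMField.complexConj L) hw) ((StdForm.antidiagonal 3).over (w.1.adicCompletion L)))) : GL (Fin 3) (w.1.adicCompletion L)) : Matrix (Fin 3) (Fin 3) (w.1.adicCompletion L)) =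
        !![1, 0, 0; -galAdicCompletionMap (L := L) (IsCMField.complexConj L) hw x, 1, 0; z, x, 1] := hlow
    exact ⟨by simpa [hlow'] using h 2 0, by simpa [hlow'] using h 2 1⟩
  · rintro ⟨hz, hx⟩
    refine mem_levelGroup_of_coe_eq_lower L v w hw eA r₁ r₂ Jg hJg Je hJe hlow ?_ hx hz
    rw [Valuation.map_neg, hvσ]; exact hx

/-! ## §3 The four integrands as indicators -/
section Eigen
variable (χ₁ : (LocalRing L v)ˣ →* ℂˣ)
open Classical in
include hw heA hJg hJe hw₀ in
set_option maxHeartbeats 1600000 in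
set_option synthInstance.maxHeartbeats 400000 in
-- two carriers, slow unification (class of FILE A)
/-- **`f(w₀ n) = 𝟙_{B(r₁,0)}(n)`** for a `(J_e, θ)`-eigen `f` with `f(1) = 0`, `f(w₀) = 1` (the normalised `f_w`): FILE A `toFun_weyl_mul_eq_of_mem` on `J_e`, FILE A′ `toFun_weyl_mul_eq_zero_of_not_mem`
off it, §2.  Memo (M12): `Λ_1 f_w = vol(N ∩ J_e)`. [cite: Casselman1980, §3] [cite: Roche1998, §3–§4] [cite: Keys1984, §7 Theorem (2) p. 126] -/
theorem toFun_weyl_mul_eq_indicator_box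
    (f : haveI := locallyCompactSpace_cmBorelU L 3 v
      Representation.SmoothInd (cmBorelTriple L 3 v).P
        (Representation.twist (((Representation.trivial ℂ ↥(torusU (conjLocal L (IsCMField.complexConj L) v) (cmLocalForm L 3 v)) ℂ).twist
          (cmTorusCharPair L v χ₁ 1)).comp (cmBorelTriple L 3 v).proj) (rootDeltaChar (cmBorelTriple L 3 v).P)))
    (heig : ∀ x ∈ Je, (haveI := locallyCompactSpace_cmBorelU L 3 v; Representation.smoothIndRep _ _ x f) =
      (if h : IsUnit (((x.val : GL (Fin 3) (LocalRing L v)) : Matrix (Fin 3) (Fin 3) (LocalRing L v)) 0 0) then ((χ₁ h.unit : ℂˣ) : ℂ) else 0) • f)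
    (R : Set ↥(unitaryGroupOfForm (conjLocal L (IsCMField.complexConj L) v) (cmLocalForm L 3 v)))
    (hR : ∀ r : ↥(unitaryGroupOfForm (conjLocal L (IsCMField.complexConj L) v) (cmLocalForm L 3 v)), r ∈ R ↔
    r ∈ ((cmBorelTriple L 3 v).N).map (MulAut.conj w₀).toMonoidHom ∧ r ∉ Je ∧
      ¬ (Valued.v ((((eA r : ↥(unitaryGroupOfForm (galAdicCompletionMap (L := L) (IsCMField.complexConj L) hw) ((StdForm.antidiagonal 3).over (w.1.adicCompletion L)))) : GL (Fin 3) (w.1.adicCompletion L)) : Matrix (Fin 3) (Fin 3) (w.1.adicCompletion L)) 2 1 /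
            (((eA r : ↥(unitaryGroupOfForm (galAdicCompletionMap (L := L) (IsCMField.complexConj L) hw) ((StdForm.antidiagonal 3).over (w.1.adicCompletion L)))) : GL (Fin 3) (w.1.adicCompletion L)) : Matrix (Fin 3) (Fin 3) (w.1.adicCompletion L)) 2 0) ≤ Valued.v ϖ ^ r₁ ∧
          (Valued.v ϖ ^ 0)⁻¹ ≤ Valued.v ((((eA r : ↥(unitaryGroupOfForm (galAdicCompletionMap (L := L) (IsCMField.complexConj L) hw) ((StdForm.antidiagonal 3).over (w.1.adicCompletion L)))) : GL (Fin 3) (w.1.adicCompletion L)) : Matrix (Fin 3) (Fin 3) (w.1.adicCompletion L)) 2 0)))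
    (hwit : ∀ r ∈ R, ∃ b₀ : ↥(unitaryGroupOfForm (conjLocal L (IsCMField.complexConj L) v) (cmLocalForm L 3 v)), b₀ ∈ Je ∧ ∃ hb₀P : r * b₀ * r⁻¹ ∈ (cmBorelTriple L 3 v).P,
      (if h : IsUnit (((b₀ : GL (Fin 3) (LocalRing L v)) : Matrix (Fin 3) (Fin 3) (LocalRing L v)) 0 0) then ((χ₁ h.unit : ℂˣ) : ℂ) else 0) ≠
        (haveI := locallyCompactSpace_cmBorelU L 3 v
         (Representation.twist
            (((Representation.trivial ℂ ↥(torusU (conjLocal L (IsCMField.complexConj L) v) (cmLocalForm L 3 v)) ℂ).twist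
              (cmTorusCharPair L v χ₁ 1)).comp (cmBorelTriple L 3 v).proj) (rootDeltaChar (cmBorelTriple L 3 v).P))
          ⟨r * b₀ * r⁻¹, hb₀P⟩ 1))
    (hw1 : f.toFun 1 = 0) (hwg : f.toFun w₀ = 1) (n : ↥(cmBorelTriple L 3 v).N) :
    f.toFun (w₀ * (n : ↥(unitaryGroupOfForm (conjLocal L (IsCMField.complexConj L) v) (cmLocalForm L 3 v)))) = Set.indicator {m : ↥(cmBorelTriple L 3 v).N | Valued.v (((((m : ↥(unitaryGroupOfForm (conjLocal L (IsCMField.complexConj L) v) (cmLocalForm L 3 v))) : GL (Fin 3) (LocalRing L v)) : Matrix (Fin 3) (Fin 3) (LocalRing L v)) 0 2) w) ≤ Valued.v ϖ ^ 0 ∧ Valued.v (((((m : ↥(unitaryGroupOfForm (conjLocal L (IsCMField.complexConj L) v) (cmLocalForm L 3 v))) : GL (Fin 3) (LocalRing L v)) : Matrix (Fin 3) (Fin 3) (LocalRing L v)) 0 1) w) ≤ Valued.v ϖ ^ r₁} (fun _ => (1 : ℂ)) n := by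
  haveI := locallyCompactSpace_cmBorelU L 3 v
  by_cases hJ : ((n : ↥(unitaryGroupOfForm (conjLocal L (IsCMField.complexConj L) v) (cmLocalForm L 3 v))) : Gqs L v) ∈ Je
  · have hmem : n ∈ {m : ↥(cmBorelTriple L 3 v).N | Valued.v (((((m : ↥(unitaryGroupOfForm (conjLocal L (IsCMField.complexConj L) v) (cmLocalForm L 3 v))) : GL (Fin 3) (LocalRing L v)) : Matrix (Fin 3) (Fin 3) (LocalRing L v)) 0 2) w) ≤ Valued.v ϖ ^ 0 ∧ Valued.v (((((m : ↥(unitaryGroupOfForm (conjLocal L (IsCMField.complexConj L) v) (cmLocalForm L 3 v))) : GL (Fin 3) (LocalRing L v)) : Matrix (Fin 3) (Fin 3) (LocalRing L v)) 0 1) w) ≤ Valued.v ϖ ^ r₁} := by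
      rw [← setOf_mem_levelGroup_eq_box L v w hw eA heA r₁ r₂ Jg hJg Je hJe]; exact hJ
    rw [Set.indicator_of_mem hmem]
    exact (toFun_weyl_mul_eq_of_mem L v Je w₀ χ₁ f heig n.2 hJ).trans hwg
  · have hnot : n ∉ {m : ↥(cmBorelTriple L 3 v).N | Valued.v (((((m : ↥(unitaryGroupOfForm (conjLocal L (IsCMField.complexConj L) v) (cmLocalForm L 3 v))) : GL (Fin 3) (LocalRing L v)) : Matrix (Fin 3) (Fin 3) (LocalRing L v)) 0 2) w) ≤ Valued.v ϖ ^ 0 ∧ Valued.v (((((m : ↥(unitaryGroupOfForm (conjLocal L (IsCMField.complexConj L) v) (cmLocalForm L 3 v))) : GL (Fin 3) (LocalRing L v)) : Matrix (Fin 3) (Fin 3) (LocalRing L v)) 0 1) w) ≤ Valued.v ϖ ^ r₁} := by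
      rw [← setOf_mem_levelGroup_eq_box L v w hw eA heA r₁ r₂ Jg hJg Je hJe]; exact hJ
    rw [Set.indicator_of_notMem hnot]
    exact toFun_weyl_mul_eq_zero_of_not_mem L v w hw eA heA r₁ r₂ Jg hJg Je hJe w₀ hw₀ χ₁ f heig R hR hwit hw1 n.2 hJ

open Classical in
include hw heA hϖ hJg hJe hw₀ in
set_option maxHeartbeats 1600000 in
set_option synthInstance.maxHeartbeats 400000 in
/-- **`f(w₀ n w₀) = 𝟙_{B(r₂,1)}(n)`** for a `(J_e, θ)`-eigen `f` with `f(1) = 1`, `f(w₀) = 0` (the normalised `f₁`): FILE A `toFun_conj_weyl_eq_of_mem`, FILE A′ `toFun_conj_weyl_eq_zero_of_not_mem`,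
§2.  Memo (M21): `Λ_{w₀} f₁ = vol{n : w₀nw₀ ∈ J_e}`. [cite: Casselman1980, §3] [cite: Roche1998, §3–§4] [cite: Keys1984, §7 Theorem (2) p. 126] -/
theorem toFun_conj_weyl_eq_indicator_box
    (f : haveI := locallyCompactSpace_cmBorelU L 3 v
      Representation.SmoothInd (cmBorelTriple L 3 v).P
        (Representation.twist (((Representation.trivial ℂ ↥(torusU (conjLocal L (IsCMField.complexConj L) v) (cmLocalForm L 3 v)) ℂ).twist
          (cmTorusCharPair L v χ₁ 1)).comp (cmBorelTriple L 3 v).proj) (rootDeltaChar (cmBorelTriple L 3 v).P)))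
    (heig : ∀ x ∈ Je, (haveI := locallyCompactSpace_cmBorelU L 3 v; Representation.smoothIndRep _ _ x f) =
      (if h : IsUnit (((x.val : GL (Fin 3) (LocalRing L v)) : Matrix (Fin 3) (Fin 3) (LocalRing L v)) 0 0) then ((χ₁ h.unit : ℂˣ) : ℂ) else 0) • f)
    (R : Set ↥(unitaryGroupOfForm (conjLocal L (IsCMField.complexConj L) v) (cmLocalForm L 3 v)))
    (hR : ∀ r : ↥(unitaryGroupOfForm (conjLocal L (IsCMField.complexConj L) v) (cmLocalForm L 3 v)), r ∈ R ↔
    r ∈ ((cmBorelTriple L 3 v).N).map (MulAut.conj w₀).toMonoidHom ∧ r ∉ Je ∧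
      ¬ (Valued.v ((((eA r : ↥(unitaryGroupOfForm (galAdicCompletionMap (L := L) (IsCMField.complexConj L) hw) ((StdForm.antidiagonal 3).over (w.1.adicCompletion L)))) : GL (Fin 3) (w.1.adicCompletion L)) : Matrix (Fin 3) (Fin 3) (w.1.adicCompletion L)) 2 1 /
            (((eA r : ↥(unitaryGroupOfForm (galAdicCompletionMap (L := L) (IsCMField.complexConj L) hw) ((StdForm.antidiagonal 3).over (w.1.adicCompletion L)))) : GL (Fin 3) (w.1.adicCompletion L)) : Matrix (Fin 3) (Fin 3) (w.1.adicCompletion L)) 2 0) ≤ Valued.v ϖ ^ r₁ ∧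
          (Valued.v ϖ ^ 0)⁻¹ ≤ Valued.v ((((eA r : ↥(unitaryGroupOfForm (galAdicCompletionMap (L := L) (IsCMField.complexConj L) hw) ((StdForm.antidiagonal 3).over (w.1.adicCompletion L)))) : GL (Fin 3) (w.1.adicCompletion L)) : Matrix (Fin 3) (Fin 3) (w.1.adicCompletion L)) 2 0)))
    (hwit : ∀ r ∈ R, ∃ b₀ : ↥(unitaryGroupOfForm (conjLocal L (IsCMField.complexConj L) v) (cmLocalForm L 3 v)), b₀ ∈ Je ∧ ∃ hb₀P : r * b₀ * r⁻¹ ∈ (cmBorelTriple L 3 v).P,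
      (if h : IsUnit (((b₀ : GL (Fin 3) (LocalRing L v)) : Matrix (Fin 3) (Fin 3) (LocalRing L v)) 0 0) then ((χ₁ h.unit : ℂˣ) : ℂ) else 0) ≠
        (haveI := locallyCompactSpace_cmBorelU L 3 v
         (Representation.twist
            (((Representation.trivial ℂ ↥(torusU (conjLocal L (IsCMField.complexConj L) v) (cmLocalForm L 3 v)) ℂ).twist
              (cmTorusCharPair L v χ₁ 1)).comp (cmBorelTriple L 3 v).proj) (rootDeltaChar (cmBorelTriple L 3 v).P))
          ⟨r * b₀ * r⁻¹, hb₀P⟩ 1))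
    (h11 : f.toFun 1 = 1) (h1g : f.toFun w₀ = 0) (n : ↥(cmBorelTriple L 3 v).N) :
    f.toFun (w₀ * (n : ↥(unitaryGroupOfForm (conjLocal L (IsCMField.complexConj L) v) (cmLocalForm L 3 v))) * w₀) = Set.indicator {m : ↥(cmBorelTriple L 3 v).N | Valued.v (((((m : ↥(unitaryGroupOfForm (conjLocal L (IsCMField.complexConj L) v) (cmLocalForm L 3 v))) : GL (Fin 3) (LocalRing L v)) : Matrix (Fin 3) (Fin 3) (LocalRing L v)) 0 2) w) ≤ Valued.v ϖ ^ 1 ∧ Valued.v (((((m : ↥(unitaryGroupOfForm (conjLocal L (IsCMField.complexConj L) v) (cmLocalForm L 3 v))) : GL (Fin 3) (LocalRing L v)) : Matrix (Fin 3) (Fin 3) (LocalRing L v)) 0 1) w) ≤ Valued.v ϖ ^ r₂} (fun _ => (1 : ℂ)) n := by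
  haveI := locallyCompactSpace_cmBorelU L 3 v
  by_cases hJ : ((w₀ * (n : ↥(unitaryGroupOfForm (conjLocal L (IsCMField.complexConj L) v) (cmLocalForm L 3 v))) * w₀ : ↥(unitaryGroupOfForm (conjLocal L (IsCMField.complexConj L) v) (cmLocalForm L 3 v))) : Gqs L v) ∈ Je
  · have hmem : n ∈ {m : ↥(cmBorelTriple L 3 v).N | Valued.v (((((m : ↥(unitaryGroupOfForm (conjLocal L (IsCMField.complexConj L) v) (cmLocalForm L 3 v))) : GL (Fin 3) (LocalRing L v)) : Matrix (Fin 3) (Fin 3) (LocalRing L v)) 0 2) w) ≤ Valued.v ϖ ^ 1 ∧ Valued.v (((((m : ↥(unitaryGroupOfForm (conjLocal L (IsCMField.complexConj L) v) (cmLocalForm L 3 v))) : GL (Fin 3) (LocalRing L v)) : Matrix (Fin 3) (Fin 3) (LocalRing L v)) 0 1) w) ≤ Valued.v ϖ ^ r₂} := by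
      rw [← setOf_conj_mem_levelGroup_eq_box L v w hw eA heA r₁ r₂ Jg hJg Je hJe w₀ hw₀]; exact hJ
    rw [Set.indicator_of_mem hmem]
    exact (toFun_conj_weyl_eq_of_mem L v w hw eA heA Je w₀ hw₀ χ₁ f heig n.2 hJ).trans h11
  · have hnot : n ∉ {m : ↥(cmBorelTriple L 3 v).N | Valued.v (((((m : ↥(unitaryGroupOfForm (conjLocal L (IsCMField.complexConj L) v) (cmLocalForm L 3 v))) : GL (Fin 3) (LocalRing L v)) : Matrix (Fin 3) (Fin 3) (LocalRing L v)) 0 2) w) ≤ Valued.v ϖ ^ 1 ∧ Valued.v (((((m : ↥(unitaryGroupOfForm (conjLocal L (IsCMField.complexConj L) v) (cmLocalForm L 3 v))) : GL (Fin 3) (LocalRing L v)) : Matrix (Fin 3) (Fin 3) (LocalRing L v)) 0 1) w) ≤ Valued.v ϖ ^ r₂} := by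
      rw [← setOf_conj_mem_levelGroup_eq_box L v w hw eA heA r₁ r₂ Jg hJg Je hJe w₀ hw₀]; exact hJ
    rw [Set.indicator_of_notMem hnot]
    exact toFun_conj_weyl_eq_zero_of_not_mem L v w hw eA heA hϖ r₁ r₂ Jg hJg Je hJe w₀ hw₀ χ₁ f heig R hR hwit h1g n.2 hJ

open Classical in
include hw heA hJg hJe hw₀ in
set_option maxHeartbeats 1600000 in
set_option synthInstance.maxHeartbeats 400000 in
/-- **`f(w₀ n w₀) = 𝟙_{C(r₁,0)}(n)·F₀(n)`** for the normalised `f_w` (`f(1) = 0`, `f(w₀) = 1`): on `C(r₁, 0) = ` the SHARP cell (`1 ≤ |z|`, `|x| ≤ |ϖ|^{r₁}|z|`; `z` is a unit there, ★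
`isUnit_of_apply_ne_zero`) FILE A `toFun_conj_weyl_eq_of_sharp`, off it FILE A′ `toFun_conj_weyl_eq_zero_of_not_sharp`.  Memo (M22): the integrand of `G₂ = Λ_{w₀} f_w`, on EXACTLY the
region of the (B-5) master at `(ρ, j₀) = (r₁, 0)`. [cite: Casselman1980, §3] [cite: Casselman1995, §6.4] [cite: Keys1984, §7 Theorem (2) p. 126] -/
theorem toFun_conj_weyl_eq_indicator_cutoff
    (f : haveI := locallyCompactSpace_cmBorelU L 3 v
      Representation.SmoothInd (cmBorelTriple L 3 v).P
        (Representation.twist (((Representation.trivial ℂ ↥(torusU (conjLocal L (IsCMField.complexConj L) v) (cmLocalForm L 3 v)) ℂ).twist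
          (cmTorusCharPair L v χ₁ 1)).comp (cmBorelTriple L 3 v).proj) (rootDeltaChar (cmBorelTriple L 3 v).P)))
    (heig : ∀ x ∈ Je, (haveI := locallyCompactSpace_cmBorelU L 3 v; Representation.smoothIndRep _ _ x f) =
      (if h : IsUnit (((x.val : GL (Fin 3) (LocalRing L v)) : Matrix (Fin 3) (Fin 3) (LocalRing L v)) 0 0) then ((χ₁ h.unit : ℂˣ) : ℂ) else 0) • f)
    (R : Set ↥(unitaryGroupOfForm (conjLocal L (IsCMField.complexConj L) v) (cmLocalForm L 3 v)))
    (hR : ∀ r : ↥(unitaryGroupOfForm (conjLocal L (IsCMField.complexConj L) v) (cmLocalForm L 3 v)), r ∈ R ↔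
    r ∈ ((cmBorelTriple L 3 v).N).map (MulAut.conj w₀).toMonoidHom ∧ r ∉ Je ∧
      ¬ (Valued.v ((((eA r : ↥(unitaryGroupOfForm (galAdicCompletionMap (L := L) (IsCMField.complexConj L) hw) ((StdForm.antidiagonal 3).over (w.1.adicCompletion L)))) : GL (Fin 3) (w.1.adicCompletion L)) : Matrix (Fin 3) (Fin 3) (w.1.adicCompletion L)) 2 1 /
            (((eA r : ↥(unitaryGroupOfForm (galAdicCompletionMap (L := L) (IsCMField.complexConj L) hw) ((StdForm.antidiagonal 3).over (w.1.adicCompletion L)))) : GL (Fin 3) (w.1.adicCompletion L)) : Matrix (Fin 3) (Fin 3) (w.1.adicCompletion L)) 2 0) ≤ Valued.v ϖ ^ r₁ ∧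
          (Valued.v ϖ ^ 0)⁻¹ ≤ Valued.v ((((eA r : ↥(unitaryGroupOfForm (galAdicCompletionMap (L := L) (IsCMField.complexConj L) hw) ((StdForm.antidiagonal 3).over (w.1.adicCompletion L)))) : GL (Fin 3) (w.1.adicCompletion L)) : Matrix (Fin 3) (Fin 3) (w.1.adicCompletion L)) 2 0)))
    (hwit : ∀ r ∈ R, ∃ b₀ : ↥(unitaryGroupOfForm (conjLocal L (IsCMField.complexConj L) v) (cmLocalForm L 3 v)), b₀ ∈ Je ∧ ∃ hb₀P : r * b₀ * r⁻¹ ∈ (cmBorelTriple L 3 v).P,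
      (if h : IsUnit (((b₀ : GL (Fin 3) (LocalRing L v)) : Matrix (Fin 3) (Fin 3) (LocalRing L v)) 0 0) then ((χ₁ h.unit : ℂˣ) : ℂ) else 0) ≠
        (haveI := locallyCompactSpace_cmBorelU L 3 v
         (Representation.twist
            (((Representation.trivial ℂ ↥(torusU (conjLocal L (IsCMField.complexConj L) v) (cmLocalForm L 3 v)) ℂ).twist
              (cmTorusCharPair L v χ₁ 1)).comp (cmBorelTriple L 3 v).proj) (rootDeltaChar (cmBorelTriple L 3 v).P))
          ⟨r * b₀ * r⁻¹, hb₀P⟩ 1))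
    (hw1 : f.toFun 1 = 0) (hwg : f.toFun w₀ = 1) (n : ↥(cmBorelTriple L 3 v).N) :
    f.toFun (w₀ * (n : ↥(unitaryGroupOfForm (conjLocal L (IsCMField.complexConj L) v) (cmLocalForm L 3 v))) * w₀) = Set.indicator {n : ↥(cmBorelTriple L 3 v).N | WithZero.exp (0 : ℤ) ≤ Valued.v (((((n : ↥(unitaryGroupOfForm (conjLocal L (IsCMField.complexConj L) v) (cmLocalForm L 3 v))) : GL (Fin 3) (LocalRing L v)) : Matrix (Fin 3) (Fin 3) (LocalRing L v)) 0 2) w) ∧ Valued.v (((((n : ↥(unitaryGroupOfForm (conjLocal L (IsCMField.complexConj L) v) (cmLocalForm L 3 v))) : GL (Fin 3) (LocalRing L v)) : Matrix (Fin 3) (Fin 3) (LocalRing L v)) 0 1) w) ≤ Valued.v ϖ ^ r₁ * Valued.v (((((n : ↥(unitaryGroupOfForm (conjLocal L (IsCMField.complexConj L) v) (cmLocalForm L 3 v))) : GL (Fin 3) (LocalRing L v)) : Matrix (Fin 3) (Fin 3) (LocalRing L v)) 0 2) w)}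
      (fun n : ↥(cmBorelTriple L 3 v).N =>
        if h : IsUnit ((((n : ↥(unitaryGroupOfForm (conjLocal L (IsCMField.complexConj L) v) (cmLocalForm L 3 v))) : GL (Fin 3) (LocalRing L v)) : Matrix (Fin 3) (Fin 3) (LocalRing L v)) 0 2) then
          ((((χ₁ (Units.map ((conjLocal L (IsCMField.complexConj L) v) : LocalRing L v →* LocalRing L v) h.unit))⁻¹ : ℂˣ) : ℂ) *
            ((((unitModulusChar (LocalRing L v) h.unit)⁻¹ : ℝ≥0) : ℝ) : ℂ))
        else 0) n := by
  haveI := locallyCompactSpace_cmBorelU L 3 v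
  by_cases hmem : n ∈ {n : ↥(cmBorelTriple L 3 v).N | WithZero.exp (0 : ℤ) ≤ Valued.v (((((n : ↥(unitaryGroupOfForm (conjLocal L (IsCMField.complexConj L) v) (cmLocalForm L 3 v))) : GL (Fin 3) (LocalRing L v)) : Matrix (Fin 3) (Fin 3) (LocalRing L v)) 0 2) w) ∧ Valued.v (((((n : ↥(unitaryGroupOfForm (conjLocal L (IsCMField.complexConj L) v) (cmLocalForm L 3 v))) : GL (Fin 3) (LocalRing L v)) : Matrix (Fin 3) (Fin 3) (LocalRing L v)) 0 1) w) ≤ Valued.v ϖ ^ r₁ * Valued.v (((((n : ↥(unitaryGroupOfForm (conjLocal L (IsCMField.complexConj L) v) (cmLocalForm L 3 v))) : GL (Fin 3) (LocalRing L v)) : Matrix (Fin 3) (Fin 3) (LocalRing L v)) 0 2) w)}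
  · obtain ⟨hz, hx⟩ := hmem
    rw [WithZero.exp_zero] at hz
    have hz0 : Valued.v (((((n : ↥(unitaryGroupOfForm (conjLocal L (IsCMField.complexConj L) v) (cmLocalForm L 3 v))) : GL (Fin 3) (LocalRing L v)) : Matrix (Fin 3) (Fin 3) (LocalRing L v)) 0 2) w) ≠ 0 := (zero_lt_one.trans_le hz).ne'
    have hb : IsUnit ((((n : ↥(unitaryGroupOfForm (conjLocal L (IsCMField.complexConj L) v) (cmLocalForm L 3 v))) : GL (Fin 3) (LocalRing L v)) : Matrix (Fin 3) (Fin 3) (LocalRing L v)) 0 2) := isUnit_of_apply_ne_zero L v w hw _ ((Valuation.ne_zero_iff _).1 hz0)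
    have hsharp : Valued.v (((((n : ↥(unitaryGroupOfForm (conjLocal L (IsCMField.complexConj L) v) (cmLocalForm L 3 v))) : GL (Fin 3) (LocalRing L v)) : Matrix (Fin 3) (Fin 3) (LocalRing L v)) 0 1) w / ((((n : ↥(unitaryGroupOfForm (conjLocal L (IsCMField.complexConj L) v) (cmLocalForm L 3 v))) : GL (Fin 3) (LocalRing L v)) : Matrix (Fin 3) (Fin 3) (LocalRing L v)) 0 2) w) ≤ Valued.v ϖ ^ r₁ ∧ (Valued.v ϖ ^ 0)⁻¹ ≤ Valued.v (((((n : ↥(unitaryGroupOfForm (conjLocal L (IsCMField.complexConj L) v) (cmLocalForm L 3 v))) : GL (Fin 3) (LocalRing L v)) : Matrix (Fin 3) (Fin 3) (LocalRing L v)) 0 2) w) := by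
      refine ⟨?_, by rw [pow_zero, inv_one]; exact hz⟩
      rw [map_div₀, div_le_iff₀ (zero_lt_iff.2 hz0)]; exact hx
    rw [Set.indicator_of_mem (show n ∈ {n : ↥(cmBorelTriple L 3 v).N | WithZero.exp (0 : ℤ) ≤ Valued.v (((((n : ↥(unitaryGroupOfForm (conjLocal L (IsCMField.complexConj L) v) (cmLocalForm L 3 v))) : GL (Fin 3) (LocalRing L v)) : Matrix (Fin 3) (Fin 3) (LocalRing L v)) 0 2) w) ∧ Valued.v (((((n : ↥(unitaryGroupOfForm (conjLocal L (IsCMField.complexConj L) v) (cmLocalForm L 3 v))) : GL (Fin 3) (LocalRing L v)) : Matrix (Fin 3) (Fin 3) (LocalRing L v)) 0 1) w) ≤ Valued.v ϖ ^ r₁ * Valued.v (((((n : ↥(unitaryGroupOfForm (conjLocal L (IsCMField.complexConj L) v) (cmLocalForm L 3 v))) : GL (Fin 3) (LocalRing L v)) : Matrix (Fin 3) (Fin 3) (LocalRing L v)) 0 2) w)} from ⟨by rw [WithZero.exp_zero]; exact hz, hx⟩)]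
    simp only [dif_pos hb]
    exact (toFun_conj_weyl_eq_of_sharp L v w hw eA heA r₁ r₂ Jg hJg Je hJe w₀ hw₀ χ₁ f heig n.2 hb hsharp).trans (by rw [hwg, mul_one])
  · rw [Set.indicator_of_notMem hmem]
    refine toFun_conj_weyl_eq_zero_of_not_sharp L v w hw eA heA r₁ Je w₀ hw₀ χ₁ f heig R hR hwit hw1 n.2 fun hs => hmem ?_
    obtain ⟨hx, hz⟩ := hs
    rw [pow_zero, inv_one] at hz
    have hz0 : Valued.v (((((n : ↥(unitaryGroupOfForm (conjLocal L (IsCMField.complexConj L) v) (cmLocalForm L 3 v))) : GL (Fin 3) (LocalRing L v)) : Matrix (Fin 3) (Fin 3) (LocalRing L v)) 0 2) w) ≠ 0 := (zero_lt_one.trans_le hz).ne'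
    refine ⟨by rw [WithZero.exp_zero]; exact hz, ?_⟩
    rw [map_div₀, div_le_iff₀ (zero_lt_iff.2 hz0)] at hx; exact hx

open Classical in
include hw heA hϖ hJg hJe hw₀ in
set_option maxHeartbeats 1600000 in
set_option synthInstance.maxHeartbeats 400000 in
/-- **`f(w₀ n) = 𝟙_{C(r₂,1)}(n)·F₀(n)`** for the normalised `f₁` (`f(1) = 1`, `f(w₀) = 0`): on `C(r₂, 1) = ` the DEEP cell (`exp 1 = |ϖ|⁻¹ ≤ |z|`, `|x| ≤ |ϖ|^{r₂}|z|`) FILE A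
`toFun_weyl_mul_eq_of_deep`, off it FILE A′ `toFun_weyl_mul_eq_zero_of_not_deep`.  Memo (M11): the integrand of `G₁ = Λ_1 f₁`, on EXACTLY the region of the (B-5) master at `(ρ, j₀) = (r₂, 1)`.
[cite: Casselman1980, §3] [cite: Casselman1995, §6.4] [cite: Keys1984, §7 Theorem (2) p. 126] -/
theorem toFun_weyl_mul_eq_indicator_cutoff
    (f : haveI := locallyCompactSpace_cmBorelU L 3 v
      Representation.SmoothInd (cmBorelTriple L 3 v).P
        (Representation.twist (((Representation.trivial ℂ ↥(torusU (conjLocal L (IsCMField.complexConj L) v) (cmLocalForm L 3 v)) ℂ).twist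
          (cmTorusCharPair L v χ₁ 1)).comp (cmBorelTriple L 3 v).proj) (rootDeltaChar (cmBorelTriple L 3 v).P)))
    (heig : ∀ x ∈ Je, (haveI := locallyCompactSpace_cmBorelU L 3 v; Representation.smoothIndRep _ _ x f) =
      (if h : IsUnit (((x.val : GL (Fin 3) (LocalRing L v)) : Matrix (Fin 3) (Fin 3) (LocalRing L v)) 0 0) then ((χ₁ h.unit : ℂˣ) : ℂ) else 0) • f)
    (R : Set ↥(unitaryGroupOfForm (conjLocal L (IsCMField.complexConj L) v) (cmLocalForm L 3 v)))
    (hR : ∀ r : ↥(unitaryGroupOfForm (conjLocal L (IsCMField.complexConj L) v) (cmLocalForm L 3 v)), r ∈ R ↔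
    r ∈ ((cmBorelTriple L 3 v).N).map (MulAut.conj w₀).toMonoidHom ∧ r ∉ Je ∧
      ¬ (Valued.v ((((eA r : ↥(unitaryGroupOfForm (galAdicCompletionMap (L := L) (IsCMField.complexConj L) hw) ((StdForm.antidiagonal 3).over (w.1.adicCompletion L)))) : GL (Fin 3) (w.1.adicCompletion L)) : Matrix (Fin 3) (Fin 3) (w.1.adicCompletion L)) 2 1 /
            (((eA r : ↥(unitaryGroupOfForm (galAdicCompletionMap (L := L) (IsCMField.complexConj L) hw) ((StdForm.antidiagonal 3).over (w.1.adicCompletion L)))) : GL (Fin 3) (w.1.adicCompletion L)) : Matrix (Fin 3) (Fin 3) (w.1.adicCompletion L)) 2 0) ≤ Valued.v ϖ ^ r₁ ∧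
          (Valued.v ϖ ^ 0)⁻¹ ≤ Valued.v ((((eA r : ↥(unitaryGroupOfForm (galAdicCompletionMap (L := L) (IsCMField.complexConj L) hw) ((StdForm.antidiagonal 3).over (w.1.adicCompletion L)))) : GL (Fin 3) (w.1.adicCompletion L)) : Matrix (Fin 3) (Fin 3) (w.1.adicCompletion L)) 2 0)))
    (hwit : ∀ r ∈ R, ∃ b₀ : ↥(unitaryGroupOfForm (conjLocal L (IsCMField.complexConj L) v) (cmLocalForm L 3 v)), b₀ ∈ Je ∧ ∃ hb₀P : r * b₀ * r⁻¹ ∈ (cmBorelTriple L 3 v).P,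
      (if h : IsUnit (((b₀ : GL (Fin 3) (LocalRing L v)) : Matrix (Fin 3) (Fin 3) (LocalRing L v)) 0 0) then ((χ₁ h.unit : ℂˣ) : ℂ) else 0) ≠
        (haveI := locallyCompactSpace_cmBorelU L 3 v
         (Representation.twist
            (((Representation.trivial ℂ ↥(torusU (conjLocal L (IsCMField.complexConj L) v) (cmLocalForm L 3 v)) ℂ).twist
              (cmTorusCharPair L v χ₁ 1)).comp (cmBorelTriple L 3 v).proj) (rootDeltaChar (cmBorelTriple L 3 v).P))
          ⟨r * b₀ * r⁻¹, hb₀P⟩ 1))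
    (h11 : f.toFun 1 = 1) (h1g : f.toFun w₀ = 0) (n : ↥(cmBorelTriple L 3 v).N) :
    f.toFun (w₀ * (n : ↥(unitaryGroupOfForm (conjLocal L (IsCMField.complexConj L) v) (cmLocalForm L 3 v)))) = Set.indicator {n : ↥(cmBorelTriple L 3 v).N | WithZero.exp (1 : ℤ) ≤ Valued.v (((((n : ↥(unitaryGroupOfForm (conjLocal L (IsCMField.complexConj L) v) (cmLocalForm L 3 v))) : GL (Fin 3) (LocalRing L v)) : Matrix (Fin 3) (Fin 3) (LocalRing L v)) 0 2) w) ∧ Valued.v (((((n : ↥(unitaryGroupOfForm (conjLocal L (IsCMField.complexConj L) v) (cmLocalForm L 3 v))) : GL (Fin 3) (LocalRing L v)) : Matrix (Fin 3) (Fin 3) (LocalRing L v)) 0 1) w) ≤ Valued.v ϖ ^ r₂ * Valued.v (((((n : ↥(unitaryGroupOfForm (conjLocal L (IsCMField.complexConj L) v) (cmLocalForm L 3 v))) : GL (Fin 3) (LocalRing L v)) : Matrix (Fin 3) (Fin 3) (LocalRing L v)) 0 2) w)}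
      (fun n : ↥(cmBorelTriple L 3 v).N =>
        if h : IsUnit ((((n : ↥(unitaryGroupOfForm (conjLocal L (IsCMField.complexConj L) v) (cmLocalForm L 3 v))) : GL (Fin 3) (LocalRing L v)) : Matrix (Fin 3) (Fin 3) (LocalRing L v)) 0 2) then
          ((((χ₁ (Units.map ((conjLocal L (IsCMField.complexConj L) v) : LocalRing L v →* LocalRing L v) h.unit))⁻¹ : ℂˣ) : ℂ) *
            ((((unitModulusChar (LocalRing L v) h.unit)⁻¹ : ℝ≥0) : ℝ) : ℂ))
        else 0) n := by
  haveI := locallyCompactSpace_cmBorelU L 3 v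
  have hϖ1 : (Valued.v ϖ ^ 1)⁻¹ = WithZero.exp (1 : ℤ) := by rw [pow_one, hϖ, ← WithZero.exp_neg, neg_neg]
  by_cases hmem : n ∈ {n : ↥(cmBorelTriple L 3 v).N | WithZero.exp (1 : ℤ) ≤ Valued.v (((((n : ↥(unitaryGroupOfForm (conjLocal L (IsCMField.complexConj L) v) (cmLocalForm L 3 v))) : GL (Fin 3) (LocalRing L v)) : Matrix (Fin 3) (Fin 3) (LocalRing L v)) 0 2) w) ∧ Valued.v (((((n : ↥(unitaryGroupOfForm (conjLocal L (IsCMField.complexConj L) v) (cmLocalForm L 3 v))) : GL (Fin 3) (LocalRing L v)) : Matrix (Fin 3) (Fin 3) (LocalRing L v)) 0 1) w) ≤ Valued.v ϖ ^ r₂ * Valued.v (((((n : ↥(unitaryGroupOfForm (conjLocal L (IsCMField.complexConj L) v) (cmLocalForm L 3 v))) : GL (Fin 3) (LocalRing L v)) : Matrix (Fin 3) (Fin 3) (LocalRing L v)) 0 2) w)}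
  · obtain ⟨hz, hx⟩ := hmem
    have hz0 : Valued.v (((((n : ↥(unitaryGroupOfForm (conjLocal L (IsCMField.complexConj L) v) (cmLocalForm L 3 v))) : GL (Fin 3) (LocalRing L v)) : Matrix (Fin 3) (Fin 3) (LocalRing L v)) 0 2) w) ≠ 0 := (lt_of_lt_of_le (by simp) hz).ne'
    have hb : IsUnit ((((n : ↥(unitaryGroupOfForm (conjLocal L (IsCMField.complexConj L) v) (cmLocalForm L 3 v))) : GL (Fin 3) (LocalRing L v)) : Matrix (Fin 3) (Fin 3) (LocalRing L v)) 0 2) := isUnit_of_apply_ne_zero L v w hw _ ((Valuation.ne_zero_iff _).1 hz0)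
    have hdeep : (Valued.v ϖ ^ 1)⁻¹ ≤ Valued.v (((((n : ↥(unitaryGroupOfForm (conjLocal L (IsCMField.complexConj L) v) (cmLocalForm L 3 v))) : GL (Fin 3) (LocalRing L v)) : Matrix (Fin 3) (Fin 3) (LocalRing L v)) 0 2) w) ∧ Valued.v (((((n : ↥(unitaryGroupOfForm (conjLocal L (IsCMField.complexConj L) v) (cmLocalForm L 3 v))) : GL (Fin 3) (LocalRing L v)) : Matrix (Fin 3) (Fin 3) (LocalRing L v)) 0 1) w / ((((n : ↥(unitaryGroupOfForm (conjLocal L (IsCMField.complexConj L) v) (cmLocalForm L 3 v))) : GL (Fin 3) (LocalRing L v)) : Matrix (Fin 3) (Fin 3) (LocalRing L v)) 0 2) w) ≤ Valued.v ϖ ^ r₂ := by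
      refine ⟨by rw [hϖ1]; exact hz, ?_⟩
      rw [map_div₀, div_le_iff₀ (zero_lt_iff.2 hz0)]; exact hx
    rw [Set.indicator_of_mem (show n ∈ {n : ↥(cmBorelTriple L 3 v).N | WithZero.exp (1 : ℤ) ≤ Valued.v (((((n : ↥(unitaryGroupOfForm (conjLocal L (IsCMField.complexConj L) v) (cmLocalForm L 3 v))) : GL (Fin 3) (LocalRing L v)) : Matrix (Fin 3) (Fin 3) (LocalRing L v)) 0 2) w) ∧ Valued.v (((((n : ↥(unitaryGroupOfForm (conjLocal L (IsCMField.complexConj L) v) (cmLocalForm L 3 v))) : GL (Fin 3) (LocalRing L v)) : Matrix (Fin 3) (Fin 3) (LocalRing L v)) 0 1) w) ≤ Valued.v ϖ ^ r₂ * Valued.v (((((n : ↥(unitaryGroupOfForm (conjLocal L (IsCMField.complexConj L) v) (cmLocalForm L 3 v))) : GL (Fin 3) (LocalRing L v)) : Matrix (Fin 3) (Fin 3) (LocalRing L v)) 0 2) w)} from ⟨hz, hx⟩)]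
    simp only [dif_pos hb]
    exact (toFun_weyl_mul_eq_of_deep L v w hw eA heA hϖ r₁ r₂ Jg hJg Je hJe w₀ hw₀ χ₁ f heig n.2 hb hdeep).trans (by rw [h11, mul_one])
  · rw [Set.indicator_of_notMem hmem]
    refine toFun_weyl_mul_eq_zero_of_not_deep L v w hw eA heA hϖ r₁ r₂ Jg hJg Je hJe w₀ hw₀ χ₁ f heig R hR hwit h1g n.2 fun hd => hmem ?_
    obtain ⟨hz, hx⟩ := hd
    rw [hϖ1] at hz
    have hz0 : Valued.v (((((n : ↥(unitaryGroupOfForm (conjLocal L (IsCMField.complexConj L) v) (cmLocalForm L 3 v))) : GL (Fin 3) (LocalRing L v)) : Matrix (Fin 3) (Fin 3) (LocalRing L v)) 0 2) w) ≠ 0 := (lt_of_lt_of_le (by simp) hz).ne'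
    refine ⟨hz, ?_⟩
    rw [map_div₀, div_le_iff₀ (zero_lt_iff.2 hz0)] at hx; exact hx
end Eigen

end Summit.HodgeConjecture.HodgeConjecture.R90.S1.BposPairIntegrandsTwoDepth

end
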